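import Mathlib
import HarnessLib
import Literature.MathematicalPhysics.QuantumLattice.GaugeGroups
import Literature.MathematicalPhysics.QuantumFieldTheory.ConstructiveQFTWave0
import Summits.Ventures.LatticeQCDFlow.Exactness.FlowPushforward
import Summits.Ventures.LatticeQCDFlow.Scaling.LatticeEntropySUN
import Summits.Ventures.LatticeQCDFlow.Scaling.EntropyBudgetMeasureSU2
import Summits.Ventures.LatticeQCDFlow.Scaling.EntropyBudgetLayers
import Summits.Ventures.LatticeQCDFlow.Scaling.EntropyBudgetCoupling

/-!
# LatticeQCDFlow / Scaling — the entropy budget of an exact flow, VII: the `SU(N)` depth laws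

HONEST FRAMING: exact (Metropolis-corrected) sampling algorithms for lattice gauge theory;
figures of merit are autocorrelation/cost numbers at stated couplings and volumes; no
continuum-physics claim.

Venture `LatticeQCDFlow` (cell pub-lqcd), topic `Scaling`, THEORY-2.md §3.2 (h) / §4 row T2-AI(m)
(theory seat GEN-10).  Parts V–VI (`EntropyBudgetLayers`, `EntropyBudgetCoupling`) state the layer
and architecture forms of the depth law for `SU(2)` (unconditional, via `SU2.entropyGrowthLaw_two`).
This file records the same three statements for `SU(N)`, `N ≥ 1`, GIVEN the sharp entropy-growth
law `SUN.EntropyGrowthLaw d N` of `Scaling/LatticeEntropySUN.lean` (an item: proved in the tree for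
`N = 2`; for general `N` it is the subject of `Scaling/LatticeEntropySUNLaw.lean`, row 30) — so that
the physically relevant case `SU(3)`, `d = 4` (exponent `8·(3L⁴(1/2 − 1/L) − 1/2)`) is available the
moment the item closes:

* `SUN.essM_layers_volume_law_of` — `ESS ≤ M·K^n·e^{c·L^d}·β^{−(N²−1)((d−1)L^d(1/2 − 1/L) − 1/2)}`
  for every `n`-layer exact sampler with per-layer clamp `K` and prior density `≤ M`;
* `SUN.depth_lower_bound_of` — `ESS ≥ e^{−t}`, `K > 0` ⟹
  `(N²−1)((d−1)L^d(1/2 − 1/L) − 1/2)·log β − c·L^d − t ≤ n·log K + log M`;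
* `SUN.depth_lower_bound_coupling_of` — the architecture form: `n` coupling layers with `≤ V_a`
  active links each and per-link clamp `ℓ ≥ 0` ⟹ `… ≤ n·(ℓ·V_a) + log M`.

References as in Parts III–VI. [folklore]
-/

noncomputable section

namespace Summit.Ventures.LatticeQCDFlow.Theory2.Lattice

open MeasureTheory Summit.Ventures.LatticeQCDFlow.Exactness
open Literature.MathematicalPhysics.QuantumLattice Literature.MathematicalPhysics.QuantumFieldTheory
open scoped ENNReal

/-- **Volume × coupling law for LAYERED exact flow samplers of `SU(N)`, given the entropy-growth
law `SUN.EntropyGrowthLaw d N`.** [folklore] -/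
theorem SUN.essM_layers_volume_law_of (d N : ℕ) (h : SUN.EntropyGrowthLaw d N) (hN : 1 ≤ N) :
    ∃ c : ℝ, ∀ (L : ℕ) [NeZero L], 2 ≤ L → ∀ β : ℝ, 1 ≤ β →
      ∀ (ls : List ((GaugeConfig d L (Matrix.specialUnitaryGroup (Fin N) ℂ) ≃ᵐ
          GaugeConfig d L (Matrix.specialUnitaryGroup (Fin N) ℂ)) ×
          (GaugeConfig d L (Matrix.specialUnitaryGroup (Fin N) ℂ) → ℝ)))
        (r : GaugeConfig d L (Matrix.specialUnitaryGroup (Fin N) ℂ) → ℝ) (K M : ℝ),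
        (∀ l ∈ ls, HasJacobian (Measure.pi fun _ : Edge d L =>
            haarProbability (Matrix.specialUnitaryGroup (Fin N) ℂ)) l.1
          fun V => ENNReal.ofReal (l.2 V)) →
        (∀ l ∈ ls, Measurable l.2) → (∀ l ∈ ls, ∀ V, 0 < l.2 V) →
        (∀ l ∈ ls, ∀ V, (l.2 V)⁻¹ ≤ K) →
        Measurable r → (∀ V, 0 < r V) → (∀ V, r V ≤ M) →
          essM (wilsonMeasure (d := d) (L := L) (fundamentalRep (Fin N)) β)
              (Measure.map (layersEquiv ls) ((Measure.pi fun _ : Edge d L =>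
                  haarProbability (Matrix.specialUnitaryGroup (Fin N) ℂ)).withDensity
                fun V => ENNReal.ofReal (r V))) ≤
            M * K ^ ls.length * Real.exp (c * (L : ℝ) ^ d) *
              β ^ (-(((N : ℝ) ^ 2 - 1) *
                (((d : ℝ) - 1) * (L : ℝ) ^ d * (1 / 2 - 1 / L) - 1 / 2))) := by
  obtain ⟨c, hc⟩ := SUN.essM_flow_volume_law_of d N h hN
  refine ⟨c, fun L _ hL β hβ ls r K M hJ hm h0 hK hr hr0 hrM => ?_⟩
  exact hc L hL β hβ (layersEquiv ls) (layersJac ls) r (K ^ ls.length) M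
    (hasJacobian_layers _ ls hJ h0) (measurable_layersJac ls hm) (layersJac_pos ls h0)
    (layersJac_inv_le ls h0 hK) hr hr0 hrM

/-- **The depth law for `SU(N)`, given `SUN.EntropyGrowthLaw d N`:** an `n`-layer exact sampler
with per-layer clamp `K > 0` and prior density `≤ M` keeping `ESS ≥ e^{−t}` at `β ≥ 1` on `L^d`
(`L ≥ 2`) has `n·log K + log M ≥ (N²−1)((d−1)L^d(1/2 − 1/L) − 1/2)·log β − c·L^d − t`.
[folklore] -/
theorem SUN.depth_lower_bound_of (d N : ℕ) (h : SUN.EntropyGrowthLaw d N) (hN : 1 ≤ N) :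
    ∃ c : ℝ, ∀ (L : ℕ) [NeZero L], 2 ≤ L → ∀ β : ℝ, 1 ≤ β →
      ∀ (ls : List ((GaugeConfig d L (Matrix.specialUnitaryGroup (Fin N) ℂ) ≃ᵐ
          GaugeConfig d L (Matrix.specialUnitaryGroup (Fin N) ℂ)) ×
          (GaugeConfig d L (Matrix.specialUnitaryGroup (Fin N) ℂ) → ℝ)))
        (r : GaugeConfig d L (Matrix.specialUnitaryGroup (Fin N) ℂ) → ℝ) (K M t : ℝ),
        (∀ l ∈ ls, HasJacobian (Measure.pi fun _ : Edge d L =>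
            haarProbability (Matrix.specialUnitaryGroup (Fin N) ℂ)) l.1
          fun V => ENNReal.ofReal (l.2 V)) →
        (∀ l ∈ ls, Measurable l.2) → (∀ l ∈ ls, ∀ V, 0 < l.2 V) →
        (∀ l ∈ ls, ∀ V, (l.2 V)⁻¹ ≤ K) → 0 < K →
        Measurable r → (∀ V, 0 < r V) → (∀ V, r V ≤ M) →
          Real.exp (-t) ≤ essM (wilsonMeasure (d := d) (L := L) (fundamentalRep (Fin N)) β)
              (Measure.map (layersEquiv ls) ((Measure.pi fun _ : Edge d L =>
                  haarProbability (Matrix.specialUnitaryGroup (Fin N) ℂ)).withDensity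
                fun V => ENNReal.ofReal (r V))) →
            ((N : ℝ) ^ 2 - 1) * (((d : ℝ) - 1) * (L : ℝ) ^ d * (1 / 2 - 1 / L) - 1 / 2) *
                Real.log β - c * (L : ℝ) ^ d - t ≤ (ls.length : ℝ) * Real.log K + Real.log M := by
  obtain ⟨c, hc⟩ := SUN.essM_layers_volume_law_of d N h hN
  refine ⟨c, fun L _ hL β hβ ls r K M t hJ hm h0 hK hK0 hr hr0 hrM hess => ?_⟩
  have hβ0 : 0 < β := one_pos.trans_le hβ
  have hM : 0 < M := (hr0 fun _ => 1).trans_le (hrM fun _ => 1)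
  have hKn : 0 < K ^ ls.length := pow_pos hK0 _
  have h := hess.trans (hc L hL β hβ ls r K M hJ hm h0 hK hr hr0 hrM)
  have hlog := Real.log_le_log (Real.exp_pos _) h
  rw [Real.log_exp, Real.log_mul (by positivity) (Real.rpow_pos_of_pos hβ0 _).ne',
    Real.log_mul (by positivity) (Real.exp_pos _).ne', Real.log_mul hM.ne' hKn.ne',
    Real.log_exp, Real.log_rpow hβ0, Real.log_pow] at hlog
  linarith

/-- **The depth law in architecture form for `SU(N)`, given `SUN.EntropyGrowthLaw d N`:** an
exact sampler of `n` coupling layers (layer `k` active on the links `P k`, at most `V_a` of them,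
single-link bijections with exact Haar-Jacobians `Jf > 0`, per-link clamp `1/Jf ≤ e^ℓ`, `ℓ ≥ 0`),
prior density `0 < r ≤ M`, keeping `ESS ≥ e^{−t}` has
`(N²−1)((d−1)L^d(1/2 − 1/L) − 1/2)·log β − c·L^d − t ≤ n·(ℓ·V_a) + log M`. [folklore] -/
theorem SUN.depth_lower_bound_coupling_of (d N : ℕ) (h : SUN.EntropyGrowthLaw d N) (hN : 1 ≤ N) :
    ∃ c : ℝ, ∀ (L : ℕ) [NeZero L], 2 ≤ L → ∀ β : ℝ, 1 ≤ β →
      ∀ (n : ℕ) (P : Fin n → Edge d L → Prop) [∀ k, DecidablePred (P k)]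
        (Ψ : (k : Fin n) → {e // P k e} → ({e // ¬P k e} → Matrix.specialUnitaryGroup (Fin N) ℂ) →
          Matrix.specialUnitaryGroup (Fin N) ℂ ≃ᵐ Matrix.specialUnitaryGroup (Fin N) ℂ)
        (Jf : (k : Fin n) → {e // P k e} → ({e // ¬P k e} → Matrix.specialUnitaryGroup (Fin N) ℂ) →
          Matrix.specialUnitaryGroup (Fin N) ℂ → ℝ)
        (hΨ : ∀ k a, Measurable fun q : Matrix.specialUnitaryGroup (Fin N) ℂ ×
          ({e // ¬P k e} → Matrix.specialUnitaryGroup (Fin N) ℂ) => Ψ k a q.2 q.1)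
        (hΨs : ∀ k a, Measurable fun q : Matrix.specialUnitaryGroup (Fin N) ℂ ×
          ({e // ¬P k e} → Matrix.specialUnitaryGroup (Fin N) ℂ) => (Ψ k a q.2).symm q.1)
        (r : GaugeConfig d L (Matrix.specialUnitaryGroup (Fin N) ℂ) → ℝ) (ℓ Va M t : ℝ),
        (∀ k a, Measurable fun q : Matrix.specialUnitaryGroup (Fin N) ℂ ×
          ({e // ¬P k e} → Matrix.specialUnitaryGroup (Fin N) ℂ) => Jf k a q.2 q.1) →
        (∀ k a y, HasJacobian (haarProbability (Matrix.specialUnitaryGroup (Fin N) ℂ)) (Ψ k a y)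
          fun g => ENNReal.ofReal (Jf k a y g)) →
        (∀ k a y g, 0 < Jf k a y g) → (∀ k a y g, (Jf k a y g)⁻¹ ≤ Real.exp ℓ) → 0 ≤ ℓ →
        (∀ k, (Fintype.card {e // P k e} : ℝ) ≤ Va) →
        Measurable r → (∀ V, 0 < r V) → (∀ V, r V ≤ M) →
          Real.exp (-t) ≤ essM (wilsonMeasure (d := d) (L := L) (fundamentalRep (Fin N)) β)
              (Measure.map (layersEquiv (List.ofFn fun k =>
                  (coupleEquiv (Ψ k) (hΨ k) (hΨs k), coupleJac (P k) (Jf k))))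
                ((Measure.pi fun _ : Edge d L =>
                  haarProbability (Matrix.specialUnitaryGroup (Fin N) ℂ)).withDensity
                  fun V => ENNReal.ofReal (r V))) →
            ((N : ℝ) ^ 2 - 1) * (((d : ℝ) - 1) * (L : ℝ) ^ d * (1 / 2 - 1 / L) - 1 / 2) *
                Real.log β - c * (L : ℝ) ^ d - t ≤ (n : ℝ) * (ℓ * Va) + Real.log M := by
  obtain ⟨c, hc⟩ := SUN.depth_lower_bound_of d N h hN
  refine ⟨c, fun L _ hL β hβ n P _ Ψ Jf hΨ hΨs r ℓ Va M t hJf hJ h0 hl hℓ hVa hr hr0 hrM hess => ?_⟩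
  set ls := List.ofFn fun k => (coupleEquiv (Ψ k) (hΨ k) (hΨs k), coupleJac (P k) (Jf k))
    with hls
  have hK0 : 0 < Real.exp (ℓ * Va) := Real.exp_pos _
  have h1 : ∀ l ∈ ls, HasJacobian (Measure.pi fun _ : Edge d L =>
      haarProbability (Matrix.specialUnitaryGroup (Fin N) ℂ)) l.1
      fun V => ENNReal.ofReal (l.2 V) := by
    rw [hls, List.forall_mem_ofFn_iff]
    intro k
    simp only [coe_coupleEquiv]
    exact hasJacobian_coupleFun (ψ := fun a y g => Ψ k a y g)
      (haarProbability (Matrix.specialUnitaryGroup (Fin N) ℂ)) (hΨ k) (hJf k) (hJ k)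
      fun a y g => (h0 k a y g).le
  have h2 : ∀ l ∈ ls, Measurable l.2 := by
    rw [hls, List.forall_mem_ofFn_iff]
    intro k
    exact measurable_coupleJac (hJf k)
  have h3 : ∀ l ∈ ls, ∀ V, 0 < l.2 V := by
    rw [hls, List.forall_mem_ofFn_iff]
    intro k V
    exact coupleJac_pos (h0 k) V
  have h4 : ∀ l ∈ ls, ∀ V, (l.2 V)⁻¹ ≤ Real.exp (ℓ * Va) := by
    rw [hls, List.forall_mem_ofFn_iff]
    intro k V
    exact (coupleJac_inv_le (h0 k) (hl k) V).trans
      (Real.exp_le_exp.mpr (mul_le_mul_of_nonneg_left (hVa k) hℓ))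
  have hmain := hc L hL β hβ ls r (Real.exp (ℓ * Va)) M t h1 h2 h3 h4 hK0 hr hr0 hrM hess
  simpa only [hls, List.length_ofFn, Real.log_exp] using hmain

end Summit.Ventures.LatticeQCDFlow.Theory2.Lattice

end
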